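import Summits.HodgeConjecture.HodgeConjecture.Theorems.LinearSystemTorelliLocalTubeSpanPartnersGenerate
import Summits.HodgeConjecture.HodgeConjecture.Theorems.LinearSystemTorelliLocalTubeSpanPairMoves
import Summits.HodgeConjecture.HodgeConjecture.Theorems.LinearSystemTorelliLocalTubeSpanPlaneEuclid
import Summits.HodgeConjecture.HodgeConjecture.Theorems.LinearSystemTorelliLocalTubeSpanUnimodularTransitivityLocal
import Summits.HodgeConjecture.HodgeConjecture.Theorems.LinearSystemTorelliLocalTubeSpanStarBasisOfCompanions

/-!
# Route LinearSystemTorelli — crux `LocalTubeSpan` (stmt-HodgeConjecture-2490): JANSSEN'S THEOREM 2.9 HOLDS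

Composition file of line `Sketch`, cycle 8 (continuation lead c7).  The named fact
`Literature.AlgebraicGeometry.HodgeTheory.Janssen1983_thm2_9` — W. Janssen, *Skew-symmetric vanishing
lattices and their monodromy groups*, Math. Ann. 266 (1983), Thm. 2.9: for an integral vanishing lattice
`(V, ⟨ , ⟩, Δ)`, `x ∈ Δ` iff `x` is unimodular and `x ≡ δ (mod 2V)` for some `δ ∈ Δ` — is PROVED here,
with no named fact as input (`localTubeSpan_janssen1983_thm2_9_holds`).  Cycle 7 had reduced it to
Janssen's Theorem 2.5 (the level-2 moves of `Sp♯₂(ℤΔ)` were taken from `Γ_Δ ⊇ Sp♯₂`); cycle 8 supplies the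
moves at the base pair directly:

* `localTubeSpan_janssen_lemma2_7` — JANSSEN'S LEMMA 2.7 ([Schnell2010] §7): `ℤΔ` is generated by any
  `u ∈ Δ` together with its partners `{δ ∈ Δ : ⟨u, δ⟩ = 1}` (`…PartnersGenerate` with the pencil Euclid of
  `…PlaneEuclid` discharged);
* `localTubeSpan_pairMoves` — for a unimodular pair `u, w ∈ Δ` and EVERY lattice vector `m ⟂ u` some
  element of `Γ_Δ` acts as the level-2 pair move `E_{u,m}² : v ↦ v + 2(⟨v,u⟩m + ⟨v,m⟩u)` (six squares of
  transvections along elements of `Δ`, the Heisenberg law, Lemma 2.7: `…PairMoves`);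
* `localTubeSpan_unimodularTransitivity_skewVanishingLattice` — hence (cycle 7's Euclid game with these
  LOCAL moves, `…UnimodularTransitivityLocal`) `Γ_Δ` acts transitively on the unimodular vectors of the
  class of `δ` modulo `2ℤΔ`, for every `δ ∈ Δ`;
* `localTubeSpan_janssen1983_thm2_9_holds : Janssen1983_thm2_9`, and the now UNCONDITIONAL consequences:
  radical companions `δ + 2β ∈ Δ` (`localTubeSpan_add_two_smul_mem`), general companions, and the star
  basis of cycle 6/7 (`localTubeSpan_exists_starBasis_holds`).

No named facts; no `sorry`.
-/

-- `Summit.HodgeConjecture.HodgeConjecture.Theorems` is the mandated namespace (single-conjunct summit: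
-- Sub = Summit), which `linter.dupNamespace` flags on every declaration; the lakefile turns the
-- linter off tree-wide (weak option), restated here so stand-alone elaboration is warning-free too.
set_option linter.dupNamespace false

noncomputable section

open Literature.AlgebraicGeometry.HodgeTheory

namespace Summit.HodgeConjecture.HodgeConjecture.Theorems

variable {V : Type} [AddCommGroup V] [Module ℚ V]

/-- **Janssen's Lemma 2.7** ([Schnell2010] §7, proof of Lemma 11: "V is already generated by the
smaller set `Δ₁ = {δ ∈ Δ : ⟨δ₁, δ⟩ = 1 or δ = δ₁}`"), unconditionally: for a skew vanishing lattice and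
`u ∈ Δ`, the lattice `ℤΔ` is generated by `u` and the partners of `u`.
[cite: Schnell2010, §7 (proof of Lemma 11)] -/
theorem localTubeSpan_janssen_lemma2_7 (B : LinearMap.BilinForm ℚ V) (hB : B.IsAlt) (Δ : Set V)
    (hΔ : IsSkewVanishingLattice B Δ) {u : V} (hu : u ∈ Δ) :
    Submodule.span ℤ (insert u {δ ∈ Δ | B u δ = 1}) = Submodule.span ℤ Δ :=
  localTubeSpan_partnersGenerate B hB Δ hΔ
    (fun huw tu tw htu htw ε hb hc => localTubeSpan_planeEuclid B hB huw tu tw htu htw ε hb hc) hu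

/-- **Level-2 pair moves along a vanishing cycle are monodromy** (no named fact): for a skew vanishing
lattice, a unimodular pair `u, w ∈ Δ` (`⟨u, w⟩ = 1`) and every lattice vector `m ⟂ u`, some element of
`Γ_Δ` acts as `E_{u,m}² : v ↦ v + 2(⟨v,u⟩m + ⟨v,m⟩u)`. [cite: Janssen1983, Thm. 2.5] -/
theorem localTubeSpan_pairMoves (B : LinearMap.BilinForm ℚ V) (hB : B.IsAlt) (Δ : Set V)
    (hΔ : IsSkewVanishingLattice B Δ) {u w : V} (hu : u ∈ Δ) (hw : w ∈ Δ) (huw : B u w = 1)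
    {m : V} (hm : m ∈ Submodule.span ℤ Δ) (hum : B u m = 0) :
    ∃ g ∈ transvectionGroup B Δ, ∀ v : V,
      ((g : (V →ₗ[ℚ] V)ˣ) : V →ₗ[ℚ] V) v = v + (2 : ℚ) • (B v u • m + B v m • u) :=
  localTubeSpan_pairMoves_of_partnersGenerate B hB Δ hΔ hu hw huw
    (localTubeSpan_janssen_lemma2_7 B hB Δ hΔ hu) hm hum

/-- Squares of transvections along elements of `Δ` are moves of `Γ_Δ`: some `g ∈ Γ_Δ` acts as
`v ↦ v - 2⟨v, δ⟩δ`. [folklore] -/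
theorem localTubeSpan_sqMove_of_mem (B : LinearMap.BilinForm ℚ V) (hB : B.IsAlt) (Δ : Set V)
    {δ : V} (hδ : δ ∈ Δ) :
    ∃ g ∈ transvectionGroup B Δ, ∀ v : V,
      ((g : (V →ₗ[ℚ] V)ˣ) : V →ₗ[ℚ] V) v = v - (2 : ℚ) • (B v δ • δ) := by
  obtain ⟨t, ht, htv⟩ := localTubeSpan_pairMoves_unit_mem B hB Δ hδ
  refine ⟨t * t, mul_mem ht ht, fun v => ?_⟩
  rw [Units.val_mul, Module.End.mul_apply, htv, localTubeSpan_skewTransvection_sq_apply B hB]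

/-- For a unimodular pair `u, w ∈ Δ` (`⟨u, w⟩ = 1`), `-w ∈ Δ` (`-w = T_u (T_w u)`). [folklore] -/
theorem localTubeSpan_neg_mem_of_pair (B : LinearMap.BilinForm ℚ V) (hB : B.IsAlt) (Δ : Set V)
    (hΔ : IsSkewVanishingLattice B Δ) {u w : V} (hu : u ∈ Δ) (hw : w ∈ Δ) (huw : B u w = 1) :
    -w ∈ Δ := by
  obtain ⟨tu, htu, htuv⟩ := localTubeSpan_pairMoves_unit_mem B hB Δ hu
  obtain ⟨tw, htw, htwv⟩ := localTubeSpan_pairMoves_unit_mem B hB Δ hw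
  have hwu : B w u = -1 := by rw [← hB.neg_eq, huw]
  have h := hΔ.stable (tu * tw) (mul_mem htu htw) u hu
  have e : ((tu * tw : (V →ₗ[ℚ] V)ˣ) : V →ₗ[ℚ] V) u = -w := by
    rw [Units.val_mul, Module.End.mul_apply, htwv, htuv, skewTransvection_apply, skewTransvection_apply,
      huw, one_smul, map_sub, LinearMap.sub_apply, hB.self_eq_zero u, hwu]
    module
  rwa [e] at h

/-- The local moves at a unimodular pair `x, y ∈ Δ`: pair moves at `e ∈ {x, y}` (along `x` with partner
`y`, along `y` with partner `-x`) and the squares of `T_x, T_y, T_{x+y}` — all inside `Γ_Δ`, no named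
fact. [folklore] -/
theorem localTubeSpan_movesAtPair (B : LinearMap.BilinForm ℚ V) (hB : B.IsAlt) (Δ : Set V)
    (hΔ : IsSkewVanishingLattice B Δ) {x y : V} (hx : x ∈ Δ) (hy : y ∈ Δ) (hxy : B x y = 1) :
    (∀ e ∈ ({x, y} : Set V), ∀ f ∈ Submodule.span ℤ Δ, B e f = 0 →
      ∃ g ∈ transvectionGroup B Δ, ∀ v : V,
        ((g : (V →ₗ[ℚ] V)ˣ) : V →ₗ[ℚ] V) v = v + (2 : ℚ) • (B v e • f + B v f • e)) ∧
    (∀ a ∈ ({x, y, x + y} : Set V), ∃ g ∈ transvectionGroup B Δ, ∀ v : V,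
        ((g : (V →ₗ[ℚ] V)ˣ) : V →ₗ[ℚ] V) v = v - (2 : ℚ) • (B v a • a)) := by
  have hxyΔ : x + y ∈ Δ := localTubeSpan_pairMoves_add_mem B hB Δ hΔ hx hy hxy
  have hnegy : -y ∈ Δ := localTubeSpan_neg_mem_of_pair B hB Δ hΔ hx hy hxy
  have hnegyx : B (-y) x = 1 := by rw [map_neg, LinearMap.neg_apply, ← hB.neg_eq, neg_neg, hxy]
  have hnegx : -x ∈ Δ := localTubeSpan_neg_mem_of_pair B hB Δ hΔ hnegy hx hnegyx
  have hyx : B y (-x) = 1 := by rw [map_neg, ← hB.neg_eq, neg_neg, hxy]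
  refine ⟨fun e he f hf hef => ?_, fun a ha => ?_⟩
  · simp only [Set.mem_insert_iff, Set.mem_singleton_iff] at he
    rcases he with rfl | rfl
    · exact localTubeSpan_pairMoves B hB Δ hΔ hx hy hxy hf hef
    · exact localTubeSpan_pairMoves B hB Δ hΔ hy hnegx hyx hf hef
  · simp only [Set.mem_insert_iff, Set.mem_singleton_iff] at ha
    have haΔ : a ∈ Δ := by rcases ha with rfl | rfl | rfl <;> assumption
    exact localTubeSpan_sqMove_of_mem B hB Δ haΔ

/-- **Transitivity of the monodromy group on unimodular vectors of a class** (no named fact): for a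
skew vanishing lattice, `δ ∈ Δ` with a partner `y ∈ Δ` (`⟨δ, y⟩ = 1`), every `t ∈ δ + 2ℤΔ` that is
unimodular (`⟨t, y'⟩ = 1` for some `y' ∈ ℤΔ`) is `g δ` for some `g ∈ Γ_Δ`; in particular `t ∈ Δ`.
[cite: Janssen1983, Thm. 2.9] -/
theorem localTubeSpan_unimodularTransitivity_skewVanishingLattice (B : LinearMap.BilinForm ℚ V)
    (hB : B.IsAlt) (Δ : Set V) (hΔ : IsSkewVanishingLattice B Δ) {δ y : V} (hδ : δ ∈ Δ)
    (hy : y ∈ Δ) (hδy : B δ y = 1) {t : V} (ht : ∃ z ∈ Submodule.span ℤ Δ, t = δ + (2 : ℚ) • z)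
    (htu : ∃ y' ∈ Submodule.span ℤ Δ, B t y' = 1) :
    ∃ g ∈ transvectionGroup B Δ, ((g : (V →ₗ[ℚ] V)ˣ) : V →ₗ[ℚ] V) δ = t := by
  obtain ⟨hpair, hsq⟩ := localTubeSpan_movesAtPair B hB Δ hΔ hδ hy hδy
  exact localTubeSpan_unimodularTransitivity_local B hB Δ hΔ.integral (transvectionGroup B Δ)
    (Submodule.subset_span hδ) (Submodule.subset_span hy) hδy hpair hsq ht htu

/-- **JANSSEN'S THEOREM 2.9 HOLDS** — the named fact `Janssen1983_thm2_9` discharged, with no named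
fact as input: for a skew vanishing lattice `Δ` of an alternating form and `x ∈ ℤΔ`, `x ∈ Δ` iff `x` is
unimodular and `x ≡ δ (mod 2ℤΔ)` for some `δ ∈ Δ`.  (`⇒`: a partner `gδ₂` from the pair of the
definition and transitivity; `⇐`: transitivity of `Γ_Δ` on the unimodular vectors of the class of `δ`,
then `Γ_Δ`-stability of `Δ`.) [cite: Janssen1983, Thm. 2.9] -/
theorem localTubeSpan_janssen1983_thm2_9_holds : Janssen1983_thm2_9 := by
  intro W _ _ B hB Δ hΔ x hx
  constructor
  · intro hxΔ
    obtain ⟨δ₁, hδ₁, δ₂, hδ₂, h12⟩ := hΔ.exists_pair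
    obtain ⟨g, hg, hgx⟩ := hΔ.transitive δ₁ hδ₁ x hxΔ
    refine ⟨⟨((g : (W →ₗ[ℚ] W)ˣ) : W →ₗ[ℚ] W) δ₂,
      localTubeSpan_transvectionGroup_map_span_int B hB Δ hΔ.integral hg (Submodule.subset_span hδ₂),
      ?_⟩, x, hxΔ, 0, Submodule.zero_mem _, by rw [sub_self, smul_zero]⟩
    rw [← hgx, localTubeSpan_transvectionGroup_isometry B hB Δ hg, h12]
  · rintro ⟨⟨y', hy', hxy'⟩, δ, hδ, z, hz, hxδ⟩
    obtain ⟨δ₁, hδ₁, δ₂, hδ₂, h12⟩ := hΔ.exists_pair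
    obtain ⟨g, hg, hgδ⟩ := hΔ.transitive δ₁ hδ₁ δ hδ
    have hyΔ : ((g : (W →ₗ[ℚ] W)ˣ) : W →ₗ[ℚ] W) δ₂ ∈ Δ := hΔ.stable g hg δ₂ hδ₂
    have hδy : B δ (((g : (W →ₗ[ℚ] W)ˣ) : W →ₗ[ℚ] W) δ₂) = 1 := by
      rw [← hgδ, localTubeSpan_transvectionGroup_isometry B hB Δ hg, h12]
    have ht : ∃ z ∈ Submodule.span ℤ Δ, x = δ + (2 : ℚ) • z :=
      ⟨z, hz, by rw [two_smul, ← two_nsmul, ← hxδ, add_sub_cancel]⟩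
    obtain ⟨g', hg', hg'δ⟩ := localTubeSpan_unimodularTransitivity_skewVanishingLattice B hB Δ hΔ hδ
      hyΔ hδy ht ⟨y', hy', hxy'⟩
    rw [← hg'δ]
    exact hΔ.stable g' hg' δ hδ

/-! ### Consequences, now unconditional -/

/-- **Radical companions**, unconditionally (the shape of `IsSkewVanishingLattice.add_two_smul_mem`
with its named-fact hypothesis discharged): for `δ ∈ Δ` and `β ∈ ℤΔ` in the radical, `δ + 2β ∈ Δ`.
[cite: Janssen1983, Thm. 2.9] -/
theorem localTubeSpan_add_two_smul_mem {B : LinearMap.BilinForm ℚ V} (hB : B.IsAlt) {Δ : Set V}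
    (hΔ : IsSkewVanishingLattice B Δ) {δ β : V} (hδ : δ ∈ Δ) (hβ : β ∈ Submodule.span ℤ Δ)
    (hβrad : ∀ x ∈ Δ, B β x = 0) : δ + 2 • β ∈ Δ :=
  hΔ.add_two_smul_mem localTubeSpan_janssen1983_thm2_9_holds hB hδ hβ hβrad

/-- **Companions**, unconditionally: `δ ∈ Δ`, `⟨δ, y⟩ = 1` (`y ∈ ℤΔ`), `z ∈ ℤΔ` with `⟨z, y⟩ = 0` ⟹
`δ + 2z ∈ Δ` (it is unimodular — `⟨δ + 2z, y⟩ = 1` — and congruent to `δ`). [cite: Janssen1983, Thm. 2.9] -/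
theorem localTubeSpan_companion_holds (B : LinearMap.BilinForm ℚ V) (hB : B.IsAlt) (Δ : Set V)
    (hΔ : IsSkewVanishingLattice B Δ) {δ y z : V} (hδ : δ ∈ Δ) (hy : y ∈ Submodule.span ℤ Δ)
    (hδy : B δ y = 1) (hz : z ∈ Submodule.span ℤ Δ) (hzy : B z y = 0) :
    δ + (2 : ℚ) • z ∈ Δ := by
  have hx : δ + (2 : ℚ) • z ∈ Submodule.span ℤ Δ := by
    rw [two_smul]
    exact Submodule.add_mem _ (Submodule.subset_span hδ) (Submodule.add_mem _ hz hz)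
  refine (localTubeSpan_janssen1983_thm2_9_holds V B hB Δ hΔ _ hx).2 ⟨⟨y, hy, ?_⟩, δ, hδ, z, hz, ?_⟩
  · rw [map_add, map_smul, LinearMap.add_apply, LinearMap.smul_apply, hδy, hzy, smul_zero, add_zero]
  · rw [add_sub_cancel_left, two_smul, two_nsmul]

/-- **The star basis**, unconditionally (cycle 7's `localTubeSpan_exists_starBasis_of_companions` with the
companions now proved): a skew vanishing lattice in a finite-dimensional space contains a basis
`δ₁, …, δ_r` of `V` with `⟨δᵢ, δ_{i₀}⟩ = 1` for all `i ≠ i₀`. [cite: Schnell2010, §7 (proof of Lemma 11)] -/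
theorem localTubeSpan_exists_starBasis_holds [FiniteDimensional ℚ V] (B : LinearMap.BilinForm ℚ V)
    (hB : B.IsAlt) (Δ : Set V) (hΔ : IsSkewVanishingLattice B Δ) :
    ∃ (r : ℕ) (δ : Fin r → V) (i₀ : Fin r), r = Module.finrank ℚ V ∧ (∀ i, δ i ∈ Δ) ∧
      LinearIndependent ℚ δ ∧ ∀ i, i ≠ i₀ → B (δ i) (δ i₀) = 1 :=
  localTubeSpan_exists_starBasis_of_companions B hB Δ hΔ fun _ hδ _ hy hδy _ hz hzy =>
    localTubeSpan_companion_holds B hB Δ hΔ hδ hy hδy hz hzy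

end Summit.HodgeConjecture.HodgeConjecture.Theorems

end
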